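import Mathlib
import Summits.Ventures.PercRepro2.Defs
import Summits.Ventures.PercRepro2.Harris
import Summits.Ventures.PercRepro2.CoinDefs
import Summits.Ventures.PercRepro2.CoinReverse
import Summits.Ventures.PercRepro2.CoinLsmCoreDefs
import Summits.Ventures.PercRepro2.CoinLsmCoreU
import Summits.Ventures.PercRepro2.CoinSquareCoreDefs
import Summits.Ventures.PercRepro2.CoinD21Alg
import Summits.Ventures.PercRepro2.CoinOrTailAlg
import Summits.Ventures.PercRepro2.CoinOrTailDefs
import Summits.Ventures.PercRepro2.CoinOrTail3Cells
import Summits.Ventures.PercRepro2.CoinOrTailLsmDefs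
import Summits.Ventures.PercRepro2.CoinOrTailLsmSums

/-!
# The diamond WITH A CHORD — the first OR-tail core with JOINED routes, in the kernel (blind cell
PercRepro2, night-2 g9; proofs/NIGHT2-DARC.md §37)

`ChordCore arcs s p q a c₁ c₂ c₃ cρ cτ`: the five single-arc coins `c₁ = s → p`, `c₂ = s → q`,
`c₃ = p → q` (the CHORD between the two routes), `cρ = p → a`, `cτ = q → a` are the only coins
with an arc into `{s, p, q, a}`.  The core `U = {p, q}` has the cluster law `ν(∅) = (1−α)(1−β)`,
`ν({p}) = α(1−β)(1−γ)`, `ν({q}) = (1−α)β`, `ν({p, q}) = α(β + (1−β)γ)`, which is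
log-supermodular (the one non-trivial pair: `ν(p)ν(q) ≤ ν(∅)ν(pq)` with slack `α(1−α)(1−β)γ`),
so `darc_of_orTailLsm` applies: **row 2′DARC holds at `a → w` for the markers `p, q` and every
head** (`darc_of_chordCore`).  This core is not two independent branches (the chord joins them);
it is covered by the general form §37 only.
-/

namespace Summit.Ventures.PercRepro2.Coin

open Classical

section ChordCoreDefs

variable {V : Type*} {E : Type*} [DecidableEq V]

/-- The diamond with a chord: `s → p`, `s → q`, `p → q`, `p → a`, `q → a`, and «no other coin
enters `{s, p, q, a}`». -/
structure ChordCore (arcs : E → Finset (V × V)) (s p q a : V) (c₁ c₂ c₃ cρ cτ : E) : Prop where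
  arc₁ : arcs c₁ = {(s, p)}
  arc₂ : arcs c₂ = {(s, q)}
  arc₃ : arcs c₃ = {(p, q)}
  arcρ : arcs cρ = {(p, a)}
  arcτ : arcs cτ = {(q, a)}
  core : ∀ e, ∀ xy ∈ arcs e, (xy.2 = s ∨ xy.2 = p ∨ xy.2 = q ∨ xy.2 = a) →
    e = c₁ ∨ e = c₂ ∨ e = c₃ ∨ e = cρ ∨ e = cτ
  sp : s ≠ p
  sq : s ≠ q
  sa : s ≠ a
  pq : p ≠ q
  pa : p ≠ a
  qa : q ≠ a
  ρτ : cρ ≠ cτ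

variable {arcs : E → Finset (V × V)} {s p q a : V} {c₁ c₂ c₃ cρ cτ : E}

/-- The chord core is an OR-tail on the core `U = {p, q}`. -/
theorem ChordCore.orTailU (h : ChordCore arcs s p q a c₁ c₂ c₃ cρ cτ) :
    OrTailU arcs s {p, q} p q a cρ cτ where
  p_mem := by simp
  q_mem := by simp
  s_notin := by simp [h.sp, h.sq]
  a_notin := by simp [h.pa.symm, h.qa.symm]
  a_ne_s := h.sa.symm
  into_U := by
    intro e xy hxy hy
    simp only [Finset.mem_insert, Finset.mem_singleton] at hy ⊢
    have hc := h.core e xy hxy (by tauto)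
    rcases hc with rfl | rfl | rfl | rfl | rfl
    · rw [h.arc₁, Finset.mem_singleton] at hxy; subst hxy; simp
    · rw [h.arc₂, Finset.mem_singleton] at hxy; subst hxy; simp
    · rw [h.arc₃, Finset.mem_singleton] at hxy; subst hxy; simp
    · rw [h.arcρ, Finset.mem_singleton] at hxy; subst hxy
      simp only at hy; rcases hy with hy | hy
      · exact absurd hy h.pa.symm
      · exact absurd hy h.qa.symm
    · rw [h.arcτ, Finset.mem_singleton] at hxy; subst hxy
      simp only at hy; rcases hy with hy | hy
      · exact absurd hy h.pa.symm
      · exact absurd hy h.qa.symm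
  into_s := by
    intro e xy hxy hy
    have hc := h.core e xy hxy (Or.inl hy)
    exfalso
    rcases hc with rfl | rfl | rfl | rfl | rfl
    · rw [h.arc₁, Finset.mem_singleton] at hxy; subst hxy; exact h.sp hy.symm
    · rw [h.arc₂, Finset.mem_singleton] at hxy; subst hxy; exact h.sq hy.symm
    · rw [h.arc₃, Finset.mem_singleton] at hxy; subst hxy; exact h.sq hy.symm
    · rw [h.arcρ, Finset.mem_singleton] at hxy; subst hxy; exact h.sa hy.symm
    · rw [h.arcτ, Finset.mem_singleton] at hxy; subst hxy; exact h.sa hy.symm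
  into_a := by
    intro e xy hxy hy
    have hc := h.core e xy hxy (by simp [hy])
    rcases hc with rfl | rfl | rfl | rfl | rfl
    · rw [h.arc₁, Finset.mem_singleton] at hxy; subst hxy; exact absurd hy h.pa
    · rw [h.arc₂, Finset.mem_singleton] at hxy; subst hxy; exact absurd hy h.qa
    · rw [h.arc₃, Finset.mem_singleton] at hxy; subst hxy; exact absurd hy h.qa
    · rw [h.arcρ, Finset.mem_singleton] at hxy; subst hxy; exact Or.inl ⟨rfl, rfl⟩
    · rw [h.arcτ, Finset.mem_singleton] at hxy; subst hxy; exact Or.inr ⟨rfl, rfl⟩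
  arcs_ρ := h.arcρ
  arcs_τ := h.arcτ
  ρτ_ne := h.ρτ

omit [DecidableEq V] in
/-- The closure lemma: if `Z ⊆ {p, q, a}` and no OPEN coin carries an arc from outside `Z` into
`Z`, nothing reachable from `s` lies in `Z`. -/
lemma ChordCore.not_reach_of_closed (h : ChordCore arcs s p q a c₁ c₂ c₃ cρ cτ) {ω : Config E}
    {Z : Set V} (hZs : s ∉ Z) (hZ : ∀ v ∈ Z, v = p ∨ v = q ∨ v = a)
    (h₁ : ω c₁ = true → p ∈ Z → s ∈ Z) (h₂ : ω c₂ = true → q ∈ Z → s ∈ Z)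
    (h₃ : ω c₃ = true → q ∈ Z → p ∈ Z)
    (hρ : ω cρ = true → a ∈ Z → p ∈ Z) (hτ : ω cτ = true → a ∈ Z → q ∈ Z)
    {y : V} (hy : y ∈ Z) : ¬ Reach arcs ω s y := by
  intro hr
  have key := reach_mem_of_closed (U := Zᶜ) ?_ hZs hr
  · exact key hy
  · intro e he xy hxy hx hy'
    have hc := h.core e xy hxy (by rcases hZ _ hy' with h' | h' | h' <;> simp [h'])
    rcases hc with rfl | rfl | rfl | rfl | rfl
    · rw [h.arc₁, Finset.mem_singleton] at hxy; subst hxy; exact hx (h₁ he hy')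
    · rw [h.arc₂, Finset.mem_singleton] at hxy; subst hxy; exact hx (h₂ he hy')
    · rw [h.arc₃, Finset.mem_singleton] at hxy; subst hxy; exact hx (h₃ he hy')
    · rw [h.arcρ, Finset.mem_singleton] at hxy; subst hxy; exact hx (hρ he hy')
    · rw [h.arcτ, Finset.mem_singleton] at hxy; subst hxy; exact hx (hτ he hy')

omit [DecidableEq V] in
/-- `s ⇝ p` iff `α` is open. -/
theorem ChordCore.reach_p_iff (h : ChordCore arcs s p q a c₁ c₂ c₃ cρ cτ) (ω : Config E) :
    Reach arcs ω s p ↔ ω c₁ = true := by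
  constructor
  · intro hr
    by_cases hb1 : ω c₁ = true
    · exact hb1
    simp only [Bool.not_eq_true] at hb1
    exfalso
    refine h.not_reach_of_closed (Z := {v | v = p}) (by simp [h.sp]) (by simp) ?_ ?_ ?_ ?_ ?_
      (by simp) hr
    · intro h'; simp [hb1] at h'
    · intro _ h'; simp [h.pq.symm] at h'
    · intro _ h'; simp [h.pq.symm] at h'
    · intro _ h'; simp [h.pa.symm] at h'
    · intro _ h'; simp [h.pa.symm] at h'
  · intro h1
    exact reach_of_openArc ⟨c₁, h1, by rw [h.arc₁]; simp⟩

omit [DecidableEq V] in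
/-- `s ⇝ q` iff `β` is open or the route `α, γ` (through the chord) is open. -/
theorem ChordCore.reach_q_iff (h : ChordCore arcs s p q a c₁ c₂ c₃ cρ cτ) (ω : Config E) :
    Reach arcs ω s q ↔ ω c₂ = true ∨ (ω c₁ = true ∧ ω c₃ = true) := by
  constructor
  · intro hr
    by_cases hb2 : ω c₂ = true
    · exact Or.inl hb2
    simp only [Bool.not_eq_true] at hb2
    by_cases h13 : ω c₁ = true ∧ ω c₃ = true
    · exact Or.inr h13
    exfalso
    by_cases hb1 : ω c₁ = true
    · have hb3 : ω c₃ = false := by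
        cases hc : ω c₃
        · rfl
        · exact absurd ⟨hb1, hc⟩ h13
      refine h.not_reach_of_closed (Z := {v | v = q}) (by simp [h.sq]) (by simp) ?_ ?_ ?_ ?_ ?_
        (by simp) hr
      · intro _ h'; simp [h.pq] at h'
      · intro h'; simp [hb2] at h'
      · intro h'; simp [hb3] at h'
      · intro _ h'; simp [h.qa.symm] at h'
      · intro _ h'; simp [h.qa.symm] at h'
    · simp only [Bool.not_eq_true] at hb1
      refine h.not_reach_of_closed (Z := {v | v = p ∨ v = q}) (by simp [h.sp, h.sq]) (by simp)
        ?_ ?_ ?_ ?_ ?_ (by simp) hr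
      · intro h'; simp [hb1] at h'
      · intro h'; simp [hb2] at h'
      · intro _ _; simp
      · intro _ h'; simp [h.pa.symm, h.qa.symm] at h'
      · intro _ h'; simp [h.pa.symm, h.qa.symm] at h'
  · rintro (h2 | ⟨h1, h3⟩)
    · exact reach_of_openArc ⟨c₂, h2, by rw [h.arc₂]; simp⟩
    · have r1 : Reach arcs ω s p := reach_of_openArc ⟨c₁, h1, by rw [h.arc₁]; simp⟩
      have r2 : Reach arcs ω p q := reach_of_openArc ⟨c₃, h3, by rw [h.arc₃]; simp⟩
      exact reach_trans r1 r2

end ChordCoreDefs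

section ChordLevels

variable {V : Type*} {E : Type*} [DecidableEq V] [Fintype E] [DecidableEq E]
  {R : Type*} [Field R]
  {arcs : E → Finset (V × V)} {s p q a : V} {c₁ c₂ c₃ cρ cτ : E}

omit [Fintype E] [DecidableEq E] in
/-- On the cylinder of `b` (the coins `c₁, c₂, c₃, cρ`), membership in the level of `U = {p, q}`
is the Boolean condition `(p ∈ W ↔ b₁) ∧ (q ∈ W ↔ b₂ ∨ b₁ b₃)`. -/
lemma ChordCore.level_inter_cyl (h : ChordCore arcs s p q a c₁ c₂ c₃ cρ cτ) (W : Finset V)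
    (b : Bool × Bool × Bool × Bool) :
    coreLevel arcs s {p, q} W ∩ {ω | ω c₁ = b.1 ∧ ω c₂ = b.2.1 ∧ ω c₃ = b.2.2.1 ∧ ω cρ = b.2.2.2}
      = if (p ∈ W ↔ b.1 = true) ∧ (q ∈ W ↔ (b.2.1 = true ∨ (b.1 = true ∧ b.2.2.1 = true)))
        then {ω | ω c₁ = b.1 ∧ ω c₂ = b.2.1 ∧ ω c₃ = b.2.2.1 ∧ ω cρ = b.2.2.2} else ∅ := by
  obtain ⟨b₁, b₂, b₃, b₄⟩ := b
  ext ω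
  have hmem : ω ∈ coreLevel arcs s {p, q} W ↔
      (p ∈ W ↔ ω c₁ = true) ∧ (q ∈ W ↔ (ω c₂ = true ∨ (ω c₁ = true ∧ ω c₃ = true))) := by
    rw [mem_coreLevel]
    simp only [Finset.mem_insert, Finset.mem_singleton, forall_eq_or_imp, forall_eq,
      h.reach_p_iff, h.reach_q_iff]
  simp only [Set.mem_inter_iff, hmem, Set.mem_setOf_eq]
  split_ifs with hc
  · simp only [Set.mem_setOf_eq]
    constructor
    · rintro ⟨_, hω⟩; exact hω
    · rintro ⟨h1, h2, h3, h4⟩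
      refine ⟨?_, h1, h2, h3, h4⟩
      rw [h1, h2, h3]; exact hc
  · simp only [Set.mem_empty_iff_false, iff_false]
    rintro ⟨hW, h1, h2, h3, _⟩
    rw [h1, h2, h3] at hW
    exact hc hW

/-- The level probabilities of `U = {p, q}` as a sum over the `16` configurations of the coins
`c₁, c₂, c₃, cρ` (the tail coin is summed out). -/
theorem ChordCore.prob_level (h : ChordCore arcs s p q a c₁ c₂ c₃ cρ cτ) (pr : E → R)
    (h12 : c₁ ≠ c₂) (h13 : c₁ ≠ c₃) (h1ρ : c₁ ≠ cρ) (h23 : c₂ ≠ c₃) (h2ρ : c₂ ≠ cρ) (h3ρ : c₃ ≠ cρ)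
    (W : Finset V) :
    prob pr (coreLevel arcs s {p, q} W) = ∑ b : Bool × Bool × Bool × Bool,
      if (p ∈ W ↔ b.1 = true) ∧ (q ∈ W ↔ (b.2.1 = true ∨ (b.1 = true ∧ b.2.2.1 = true)))
        then edgeFactor (pr c₁) b.1 * edgeFactor (pr c₂) b.2.1 * edgeFactor (pr c₃) b.2.2.1 *
          edgeFactor (pr cρ) b.2.2.2 else 0 := by
  rw [prob_eq_sum_cyl4 (c₁ := c₁) (c₂ := c₂) (c₃ := c₃) (c₄ := cρ)]
  refine Finset.sum_congr rfl fun b _ => ?_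
  rw [h.level_inter_cyl W b]
  split_ifs
  · exact prob_cyl4 pr h12 h13 h1ρ h23 h2ρ h3ρ b
  · simp [prob]

/-- `ν(∅) = (1 − α)(1 − β)`. -/
theorem ChordCore.nu_empty (h : ChordCore arcs s p q a c₁ c₂ c₃ cρ cτ) (pr : E → R)
    (h12 : c₁ ≠ c₂) (h13 : c₁ ≠ c₃) (h1ρ : c₁ ≠ cρ) (h23 : c₂ ≠ c₃) (h2ρ : c₂ ≠ cρ) (h3ρ : c₃ ≠ cρ) :
    prob pr (coreLevel arcs s {p, q} ∅) = (1 - pr c₁) * (1 - pr c₂) := by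
  rw [h.prob_level pr h12 h13 h1ρ h23 h2ρ h3ρ]
  simp [Fintype.sum_prod_type]
  ring

/-- `ν({p}) = α(1 − β)(1 − γ)`. -/
theorem ChordCore.nu_p (h : ChordCore arcs s p q a c₁ c₂ c₃ cρ cτ) (pr : E → R)
    (h12 : c₁ ≠ c₂) (h13 : c₁ ≠ c₃) (h1ρ : c₁ ≠ cρ) (h23 : c₂ ≠ c₃) (h2ρ : c₂ ≠ cρ) (h3ρ : c₃ ≠ cρ) :
    prob pr (coreLevel arcs s {p, q} {p}) = pr c₁ * (1 - pr c₂) * (1 - pr c₃) := by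
  rw [h.prob_level pr h12 h13 h1ρ h23 h2ρ h3ρ]
  simp [Fintype.sum_prod_type, h.pq.symm]
  ring

/-- `ν({q}) = (1 − α)β`. -/
theorem ChordCore.nu_q (h : ChordCore arcs s p q a c₁ c₂ c₃ cρ cτ) (pr : E → R)
    (h12 : c₁ ≠ c₂) (h13 : c₁ ≠ c₃) (h1ρ : c₁ ≠ cρ) (h23 : c₂ ≠ c₃) (h2ρ : c₂ ≠ cρ) (h3ρ : c₃ ≠ cρ) :
    prob pr (coreLevel arcs s {p, q} {q}) = (1 - pr c₁) * pr c₂ := by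
  rw [h.prob_level pr h12 h13 h1ρ h23 h2ρ h3ρ]
  simp [Fintype.sum_prod_type, h.pq]
  ring

/-- `ν({p, q}) = α(β + (1 − β)γ)`. -/
theorem ChordCore.nu_pq (h : ChordCore arcs s p q a c₁ c₂ c₃ cρ cτ) (pr : E → R)
    (h12 : c₁ ≠ c₂) (h13 : c₁ ≠ c₃) (h1ρ : c₁ ≠ cρ) (h23 : c₂ ≠ c₃) (h2ρ : c₂ ≠ cρ) (h3ρ : c₃ ≠ cρ) :
    prob pr (coreLevel arcs s {p, q} {p, q}) = pr c₁ * (pr c₂ + (1 - pr c₂) * pr c₃) := by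
  rw [h.prob_level pr h12 h13 h1ρ h23 h2ρ h3ρ]
  simp [Fintype.sum_prod_type]
  ring

omit [Fintype E] [DecidableEq E] in
/-- The four subsets of `{p, q}`. -/
lemma subset_pair_cases (hpq : p ≠ q) {W : Finset V} (hW : W ⊆ {p, q}) :
    W = ∅ ∨ W = {p} ∨ W = {q} ∨ W = {p, q} := by
  have hW' : W.erase p ⊆ {q} := by
    intro x hx
    have hx' := hW (Finset.mem_of_mem_erase hx)
    simp only [Finset.mem_insert, Finset.mem_singleton] at hx' ⊢
    rcases hx' with rfl | rfl
    · exact absurd rfl (Finset.ne_of_mem_erase hx)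
    · rfl
  rcases Finset.subset_singleton_iff.1 hW' with he | he
  · by_cases hp : p ∈ W
    · right; left
      rw [← Finset.insert_erase hp, he]
      simp
    · left
      rw [← Finset.erase_eq_of_notMem hp, he]
  · by_cases hp : p ∈ W
    · right; right; right
      rw [← Finset.insert_erase hp, he]
    · right; right; left
      rw [← Finset.erase_eq_of_notMem hp, he]

/-- **The cluster law of `U = {p, q}` is log-supermodular**: the one non-trivial pair is
`ν(p)ν(q) ≤ ν(∅)ν(pq)`, with slack `α(1 − α)(1 − β)γ`. -/
theorem ChordCore.level_lsm (h : ChordCore arcs s p q a c₁ c₂ c₃ cρ cτ) (pr : E → R)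
    [LinearOrder R] [IsStrictOrderedRing R] (hp : IsProbVec pr)
    (h12 : c₁ ≠ c₂) (h13 : c₁ ≠ c₃) (h1ρ : c₁ ≠ cρ) (h23 : c₂ ≠ c₃) (h2ρ : c₂ ≠ cρ) (h3ρ : c₃ ≠ cρ) :
    ∀ W W', W ⊆ ({p, q} : Finset V) → W' ⊆ {p, q} →
      prob pr (coreLevel arcs s {p, q} W) * prob pr (coreLevel arcs s {p, q} W') ≤
        prob pr (coreLevel arcs s {p, q} (W ∩ W')) * prob pr (coreLevel arcs s {p, q} (W ∪ W')) := by
  intro W W' hW hW'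
  have hpq := h.pq
  have e1 : ({p} : Finset V) ∩ {q} = ∅ := Finset.disjoint_iff_inter_eq_empty.1
    (Finset.disjoint_singleton.2 hpq)
  have e2 : ({q} : Finset V) ∩ {p} = ∅ := Finset.disjoint_iff_inter_eq_empty.1
    (Finset.disjoint_singleton.2 hpq.symm)
  have e3 : ({p} : Finset V) ∪ {q} = {p, q} := (Finset.insert_eq p {q}).symm
  have e4 : ({q} : Finset V) ∪ {p} = {p, q} := by
    rw [Finset.union_comm]; exact (Finset.insert_eq p {q}).symm
  have e5 : ({p} : Finset V) ∩ {p, q} = {p} := Finset.inter_eq_left.2 (by simp)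
  have e6 : ({p, q} : Finset V) ∩ {p} = {p} := Finset.inter_eq_right.2 (by simp)
  have e7 : ({p} : Finset V) ∪ {p, q} = {p, q} := Finset.union_eq_right.2 (by simp)
  have e8 : ({p, q} : Finset V) ∪ {p} = {p, q} := Finset.union_eq_left.2 (by simp)
  have e9 : ({q} : Finset V) ∩ {p, q} = {q} := Finset.inter_eq_left.2 (by simp)
  have e10 : ({p, q} : Finset V) ∩ {q} = {q} := Finset.inter_eq_right.2 (by simp)
  have e11 : ({q} : Finset V) ∪ {p, q} = {p, q} := Finset.union_eq_right.2 (by simp)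
  have e12 : ({p, q} : Finset V) ∪ {q} = {p, q} := Finset.union_eq_left.2 (by simp)
  have key : 0 ≤ pr c₁ * (1 - pr c₁) * (1 - pr c₂) * pr c₃ :=
    mul_nonneg (mul_nonneg (mul_nonneg (hp.nonneg c₁) (sub_nonneg.2 (hp.le_one c₁)))
      (sub_nonneg.2 (hp.le_one c₂))) (hp.nonneg c₃)
  rcases subset_pair_cases hpq hW with rfl | rfl | rfl | rfl <;>
    rcases subset_pair_cases hpq hW' with rfl | rfl | rfl | rfl <;>
    simp only [Finset.inter_self, Finset.union_self, Finset.empty_inter, Finset.inter_empty,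
      Finset.empty_union, Finset.union_empty, e1, e2, e3, e4, e5, e6, e7, e8, e9, e10, e11, e12,
      h.nu_empty pr h12 h13 h1ρ h23 h2ρ h3ρ, h.nu_p pr h12 h13 h1ρ h23 h2ρ h3ρ,
      h.nu_q pr h12 h13 h1ρ h23 h2ρ h3ρ, h.nu_pq pr h12 h13 h1ρ h23 h2ρ h3ρ] <;>
    nlinarith [key]

end ChordLevels

section ChordMain

variable {V : Type*} {E : Type*} [Fintype V] [DecidableEq V] [Fintype E] [DecidableEq E]
  {R : Type*} [Field R] [LinearOrder R] [IsStrictOrderedRing R]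
  {arcs : E → Finset (V × V)} {s p q a w : V} {c₁ c₂ c₃ cρ cτ : E}

/-- **THEOREM (row 2′DARC over the diamond WITH A CHORD, every head).**  `ChordCore` with five
distinct coins, `SameEnds`, `t, w ∉ {s, p, q, a}` ⟹ `Φ_D({s ↛ t in D + (a → w)}) ≥ 0` for the
markers `p, q` — the first OR-tail core with joined routes in the kernel; no non-degeneracy
hypothesis. -/
theorem darc_of_chordCore (pr : E → R) (hp : IsProbVec pr) (hS : SameEnds arcs)
    (h : ChordCore arcs s p q a c₁ c₂ c₃ cρ cτ)
    (h12 : c₁ ≠ c₂) (h13 : c₁ ≠ c₃) (h1ρ : c₁ ≠ cρ) (h23 : c₂ ≠ c₃) (h2ρ : c₂ ≠ cρ) (h3ρ : c₃ ≠ cρ)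
    {t : V} (htC : t ∉ ({p, q, a} : Finset V)) (hts : t ≠ s) (hws : w ≠ s)
    (hwC : w ∉ ({p, q, a} : Finset V)) :
    DARC pr arcs s {t} p q a w := by
  have htC' : t ∉ insert a ({p, q} : Finset V) := by
    intro ht; apply htC
    simp only [Finset.mem_insert, Finset.mem_singleton] at ht ⊢; tauto
  have hwC' : w ∉ insert a ({p, q} : Finset V) := by
    intro hw; apply hwC
    simp only [Finset.mem_insert, Finset.mem_singleton] at hw ⊢; tauto
  exact darc_of_orTailLsm pr hp hS h.orTailU (h.level_lsm pr hp h12 h13 h1ρ h23 h2ρ h3ρ) htC' hts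
    hws hwC'

end ChordMain

end Summit.Ventures.PercRepro2.Coin
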